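import Summits.HodgeConjecture.CorCM.MumfordTateRankTwoEndomorphism
import Literature.AlgebraicGeometry.Pohlmann1968.SeparatingCMFamilies
import Literature.NumberTheory.ComplexMultiplication.CMTypeRankLowerBounds
import HarnessLib

/-!
# Ribet's `log₂`-bound for an ARBITRARY complex abelian variety of CM type, `4 · rdim X ≤ 2 ^ dim MT(H¹(X))`,
# and its consequence: `dim MT(H¹(X)) ≤ 3` forces stable nondegeneracy (all powers divisor-generated, HC)

COR-CM (cell `pub-hodgecm2`, seat `b27` gen 28, count-neutral lane MT-RANK-TWO, file 3; theorems only, no definition,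
no named fact; UNCONDITIONAL).  Sequel of `CorCM/MumfordTateRankOfCMAbelianVariety` (gen 27: `dim MT(H¹(X)) ≤ rdim X + 1`
with equality iff stably nondegenerate) and of `CorCM/MumfordTateRankTwoEndomorphism` (gen 28: `2 ≤ dim MT(H¹(X))`).

Ribet's bound `2 + log₂ dim A ≤ rank` for a SIMPLE CM abelian variety `A` (Ribet 1980 (3.5), Dodson 1987 Thm. 1.0 (iii);
tree: `IsCMTypeWith.two_mul_card_le_two_pow_typeRank`, whose hypothesis is only that the translates of the type
SEPARATE the embeddings, and `Pohlmann1968.four_mul_dim_le_two_pow_mtRank` on the variety) extends verbatim to the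
family of simple, pairwise non-isogenous factors of an arbitrary CM abelian variety, because that family is separating
(`CMAlgebra.isSeparatingFamily_of_isSimple_of_pairwise_not_isIsogenous`):

* `CMAlgebra.two_mul_sum_finrank_le_two_pow_cmFamilyRank` — **`2 Σ_i [K_i:ℚ] ≤ 2 ^ cmFamilyRank Φ`** for a SEPARATING
  family of CM types on CM fields;
* `four_mul_sum_dim_le_two_pow_mtRank_hodge_one` — **`4 Σ_c dim A'_c ≤ 2 ^ dim MT(H¹(X))`** for `X ∼ ⨁_j A'_{cls j}` with
  simple, pairwise non-isogenous CM representatives `A'_c`, `cls` surjective (so `Σ_c dim A'_c = rdim X`);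
* `exists_rdim_ribet_of_isOfCMType` — intrinsic: for `X` of CM type (`0 < dim X`) there is `r ≤ dim X` with
  `4 r ≤ 2 ^ dim MT(H¹(X))`, `dim MT(H¹(X)) ≤ r + 1`, and `(∀ N, B•(X^{N+1}) = D•(X^{N+1})) ↔ dim MT(H¹(X)) = r + 1`;
* **`forall_isDivisorGenerated_powSucc_of_mtRank_hodge_one_le_three`** — for `X` of CM type, **`dim MT(H¹(X)) ≤ 3` ⟹ every
  power `X^{N+1}` is divisor-generated** (the bound gives `4 r ≤ 8`, i.e. `rdim X ≤ 2`, while `dim MT ≤ rdim + 1` and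
  `dim MT ≥ 2` give `dim MT = rdim + 1`: the maximal, stably nondegenerate value), and
  `hodgeConjectureFor_powSucc_of_mtRank_hodge_one_le_three` — **the Hodge conjecture for all these powers**, UNCONDITIONAL.
  (Rank `4` is the first value attained by a degenerate CM abelian variety — e.g. Pohlmann's simple CM fourfolds with
  `dim MT = 4 < 5`, tree `Pohlmann1968/SimpleCMAbelianFourfoldPowers`.)
* `exists_sum_dim_eq_two_of_mtRank_hodge_one_eq_three` — at `dim MT(H¹(X)) = 3` the reduced dimension is `2`: `X` is
  isogenous to a product of copies of ONE simple CM surface or of TWO non-isogenous CM elliptic curves (read: the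
  representatives have total dimension `2`).

## References

* [Ribet1980] K. A. Ribet, *Division fields of abelian varieties with complex multiplication*, Mém. SMF (2) 2 (1980),
  §3 (3.5) (p. 87).
* [Dodson1987] B. Dodson, *On the Mumford–Tate group of an abelian variety with complex multiplication*, J. Algebra 111
  (1987), Thm. 1.0 (iii) (p. 51).
* [Gordon1999HodgeAVSurvey] B. B. Gordon, *A survey of the Hodge conjecture for abelian varieties* (1999), 7.4–7.7, 9.1.
* [Milne1999LefschetzClasses] J. S. Milne, *Lefschetz classes on abelian varieties*, Duke Math. J. 96 (1999), Prop. 1.1, 4.8.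
-/

noncomputable section

open scoped TensorProduct
open CategoryTheory CategoryTheory.Limits NumberField Module
open scoped BigOperators

/-! ## §1 Ribet's bound for a separating family of CM types -/

namespace Literature.AlgebraicGeometry.Pohlmann1968

open Literature.NumberTheory.ComplexMultiplication
open Literature.AlgebraicGeometry.Motives (CMType)

variable {I : Type} [Fintype I] {K : I → Type} [∀ i, Field (K i)] [∀ i, NumberField (K i)] [∀ i, IsCMField (K i)]

/-- **Ribet's `log₂`-bound for a SEPARATING family** of CM types `Φ_i` on CM fields `K_i`:
`2 Σ_i [K_i:ℚ] ≤ 2 ^ cmFamilyRank Φ` — the tree's `IsCMTypeWith.two_mul_card_le_two_pow_typeRank` (whose only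
hypothesis is Kubota separation) applied to the type `Σ = ⊔_i Φ_i` of the CM algebra `∏_i K_i` acting on
`⊔_i Hom(K_i, ℂ)` (`isCMTypeWith_familyType`; `|⊔_i Hom(K_i, ℂ)| = Σ_i [K_i:ℚ]`).  For one slot this is Dodson
Thm. 1.0 (iii) / Ribet (3.5). [cite: Dodson1987, Thm. 1.0 (iii) (p. 51)] [cite: Ribet1980, §3 (3.5) (p. 87)] -/
theorem CMAlgebra.two_mul_sum_finrank_le_two_pow_cmFamilyRank {Φ : ∀ i, CMType (K i)}
    (hsep : CMAlgebra.IsSeparatingFamily Φ) :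
    2 * ∑ i, Module.finrank ℚ (K i) ≤ 2 ^ CMAlgebra.cmFamilyRank Φ := by
  have hcard : Fintype.card ((i : I) × (K i →+* ℂ)) = ∑ i, Module.finrank ℚ (K i) := by
    rw [Fintype.card_sigma]
    exact Finset.sum_congr rfl fun i _ => Embeddings.card (K i) ℂ
  rw [← hcard]
  exact (CMAlgebra.isCMTypeWith_familyType Φ).two_mul_card_le_two_pow_typeRank
    ((CMAlgebra.isSeparatingFamily_iff_smul Φ).1 hsep)

end Literature.AlgebraicGeometry.Pohlmann1968

namespace Summit.HodgeConjecture.CorCM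

open Literature.NumberTheory.ComplexMultiplication
open Literature.AlgebraicGeometry.Motives
open Literature.AlgebraicGeometry.Motives.AbelianVariety
open Literature.AlgebraicGeometry.Motives.HodgeStructure
open Literature.AlgebraicGeometry.HodgeTheory
open Literature.AlgebraicGeometry.ComplexMultiplication (IsCMTypeRealisation)
open Literature.AlgebraicGeometry.Milne1999 (IsOfCMType)
open Literature.AlgebraicGeometry.Pohlmann1968

/-! ## §2 `4 · rdim X ≤ 2 ^ dim MT(H¹(X))` on the variety -/

section Ribet

variable [HodgeTensorFacts.{0, 0}]
variable {C : Type} [Fintype C] {K' : C → Type} [∀ c, Field (K' c)] [∀ c, NumberField (K' c)]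
  [∀ c, IsCMField (K' c)] {Φ' : ∀ c, CMType (K' c)} {A' : C → AbelianVariety ℂ}
  {ι' : ∀ c, 𝓞 (K' c) →+* End (A' c)} {θ' : ∀ c, K' c →+* Module.End ℂ (complexBetti (A' c).X 1)}
  {J : Type} [Fintype J] [DecidableEq J] {cls : J → C} {X : AbelianVariety ℂ} {n : ℕ}

/-- **Ribet's bound on the variety, arbitrary CM abelian variety**: for `X ∼ ⨁_j A'_{cls j}` with SIMPLE, PAIRWISE
NON-ISOGENOUS CM realisations `A'_c` and `cls` surjective, `4 Σ_c dim A'_c ≤ 2 ^ dim MT(H¹(X))` — i.e.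
`2 + log₂ rdim X ≤ dim MT(H¹(X))` (`dim MT(H¹(X)) = cmFamilyRank Φ'`, gen 27; the family is separating; §1;
`[K_c:ℚ] = 2 dim A'_c`). [cite: Dodson1987, Thm. 1.0 (iii)] [cite: Ribet1980, §3 (3.5)] [cite: Gordon1999HodgeAVSurvey, 7.4 and 9.1] -/
theorem four_mul_sum_dim_le_two_pow_mtRank_hodge_one
    (hA : ∀ c, IsCMTypeRealisation (Φ' c) (A' c) (ι' c) (θ' c)) (hs : ∀ c, (A' c).IsSimple)
    (hniso : ∀ c c', c ≠ c' → ¬ IsIsogenous (A' c) (A' c')) (hcls : Function.Surjective cls)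
    (hX : IsSmoothProjective n X.X) (hXB : IsIsogenous X (⨁ fun j => A' (cls j))) :
    haveI := BettiUniverse.finite hX 1
    4 * ∑ c, (A' c).dim ≤ 2 ^ (BettiUniverse.hodge exists_isReal_hodgeModel_holds hX 1).mtRank := by
  rw [mtRank_hodge_one_eq_cmFamilyRank_of_isIsogenous_biproduct hA hcls hX hXB, ← sum_finrank_div_two_eq_sum_dim hA]
  have h := CMAlgebra.two_mul_sum_finrank_le_two_pow_cmFamilyRank
    (CMAlgebra.isSeparatingFamily_of_isSimple_of_pairwise_not_isIsogenous hA hs hniso)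
  omega

end Ribet

/-! ## §3 Intrinsic forms; `dim MT(H¹(X)) ≤ 3` forces stable nondegeneracy -/

section Intrinsic

variable [HodgeTensorFacts.{0, 0}] {X : AbelianVariety ℂ} {n : ℕ} (hX : IsSmoothProjective n X.X)

/-- **Hazama–Murty with Ribet, intrinsic form**: for a complex abelian variety `X` of CM type with `0 < dim X` there is
`r ≤ dim X` (the reduced dimension of any decomposition into simple, pairwise non-isogenous CM factors) with
`4 r ≤ 2 ^ dim MT(H¹(X))`, `dim MT(H¹(X)) ≤ r + 1`, and `(∀ N, B•(X^{N+1}) = D•(X^{N+1})) ↔ dim MT(H¹(X)) = r + 1`.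
[cite: Gordon1999HodgeAVSurvey, 7.4, 7.5 and 7.7] [cite: Dodson1987, Thm. 1.0 (iii)] -/
theorem exists_rdim_ribet_of_isOfCMType (h0 : 0 < X.dim) (hcm : IsOfCMType X) :
    haveI := BettiUniverse.finite hX 1
    ∃ r : ℕ, r ≤ X.dim ∧ 4 * r ≤ 2 ^ (BettiUniverse.hodge exists_isReal_hodgeModel_holds hX 1).mtRank ∧
      (BettiUniverse.hodge exists_isReal_hodgeModel_holds hX 1).mtRank ≤ r + 1 ∧
      ((∀ N : ℕ, IsDivisorGenerated (X.powSucc N)) ↔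
        (BettiUniverse.hodge exists_isReal_hodgeModel_holds hX 1).mtRank = r + 1) := by
  obtain ⟨r, hr, hle, hiff, C, _, K', _, _, _, Φ', A', ι', θ', m, cls, f, hA, hs, hniso, hcls, hf, hrsum, -⟩ :=
    exists_rdim_of_isOfCMType hX h0 hcm
  refine ⟨r, hr, ?_, hle, hiff⟩
  rw [hrsum]
  exact four_mul_sum_dim_le_two_pow_mtRank_hodge_one hA hs hniso hcls hX ⟨f, hf⟩

/-- **`dim MT(H¹(X)) ≤ 3` ⟹ `X` is stably nondegenerate**, for every complex abelian variety `X` of CM type with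
`0 < dim X`: every power `X^{N+1}` is divisor-generated.  (`4 rdim X ≤ 2 ^ dim MT ≤ 8` gives `rdim X ≤ 2`;
`2 ≤ dim MT ≤ rdim X + 1` then forces `dim MT = rdim X + 1`, the maximal value, which is Gordon 7.5 (3) ⟹ (1).)  The
three lowest values `2, 3` (and the vacuous `≤ 1`) of the Mumford–Tate rank thus carry no exceptional Hodge classes;
`4` is the first rank attained by a degenerate CM abelian variety. [cite: Gordon1999HodgeAVSurvey, 7.5 and 7.7]
[cite: Dodson1987, Thm. 1.0 (iii)] -/
theorem forall_isDivisorGenerated_powSucc_of_mtRank_hodge_one_le_three (h0 : 0 < X.dim) (hcm : IsOfCMType X)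
    (h3 : haveI := BettiUniverse.finite hX 1
      (BettiUniverse.hodge exists_isReal_hodgeModel_holds hX 1).mtRank ≤ 3) (N : ℕ) :
    IsDivisorGenerated (X.powSucc N) := by
  obtain ⟨r, -, hrib, hle, hiff⟩ := exists_rdim_ribet_of_isOfCMType hX h0 hcm
  have h2 := two_le_mtRank_hodge_one hX h0
  haveI := BettiUniverse.finite hX 1
  set t := (BettiUniverse.hodge exists_isReal_hodgeModel_holds hX 1).mtRank with ht
  -- `t ∈ {2, 3}`; `4 r ≤ 2^t ≤ 8` gives `r ≤ 2`; `t ≤ r + 1` gives `t = r + 1`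
  have hpow : 2 ^ t ≤ 8 := by
    calc 2 ^ t ≤ 2 ^ 3 := Nat.pow_le_pow_right (by norm_num) h3
      _ = 8 := by norm_num
  have hr2 : r ≤ 2 := by omega
  have heq : t = r + 1 := by
    interval_cases t
    · -- `t = 2`: `4 r ≤ 4`
      have : 4 * r ≤ 4 := by simpa using hrib
      omega
    · -- `t = 3`
      omega
  exact hiff.2 heq N

/-- **The Hodge conjecture for every power of a CM abelian variety with `dim MT(H¹(X)) ≤ 3`**, unconditionally.
[cite: Gordon1999HodgeAVSurvey, 7.5, 7.7 and 10.10] [cite: vanGeemen1994HodgeAV, §2.4] -/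
theorem hodgeConjectureFor_powSucc_of_mtRank_hodge_one_le_three (h0 : 0 < X.dim) (hcm : IsOfCMType X)
    (h3 : haveI := BettiUniverse.finite hX 1
      (BettiUniverse.hodge exists_isReal_hodgeModel_holds hX 1).mtRank ≤ 3) (N : ℕ) :
    HodgeConjectureFor (X.powSucc N).dim (X.powSucc N).X :=
  hodgeConjectureFor_of_isDivisorGenerated _
    (forall_isDivisorGenerated_powSucc_of_mtRank_hodge_one_le_three hX h0 hcm h3 N)

/-- **At `dim MT(H¹(X)) = 3` the reduced dimension is `2`**: a CM abelian variety `X` with `dim MT(H¹(X)) = 3` is isogenous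
to a product `⨁_j A'_{cls j}` of copies of simple, pairwise non-isogenous CM realisations of TOTAL dimension
`Σ_c dim A'_c = 2` — one simple CM surface, or two non-isogenous CM elliptic curves. [cite: Gordon1999HodgeAVSurvey, 7.4 and 7.5]
[cite: Dodson1987, Thm. 1.0 (iii)] -/
theorem exists_sum_dim_eq_two_of_mtRank_hodge_one_eq_three (h0 : 0 < X.dim) (hcm : IsOfCMType X)
    (h3 : haveI := BettiUniverse.finite hX 1
      (BettiUniverse.hodge exists_isReal_hodgeModel_holds hX 1).mtRank = 3) :
    ∃ (C : Type) (_ : Fintype C) (K' : C → Type) (_ : ∀ c, Field (K' c)) (_ : ∀ c, NumberField (K' c))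
      (_ : ∀ c, IsCMField (K' c)) (Φ' : ∀ c, CMType (K' c)) (A' : C → AbelianVariety ℂ)
      (ι' : ∀ c, 𝓞 (K' c) →+* End (A' c)) (θ' : ∀ c, K' c →+* Module.End ℂ (complexBetti (A' c).X 1))
      (m : ℕ) (cls : Fin (m + 1) → C) (f : X ⟶ ⨁ fun i => A' (cls i)),
      (∀ c, IsCMTypeRealisation (Φ' c) (A' c) (ι' c) (θ' c)) ∧ (∀ c, (A' c).IsSimple) ∧
      (∀ c c', c ≠ c' → ¬ IsIsogenous (A' c) (A' c')) ∧ Function.Surjective cls ∧ IsIsogeny f ∧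
      ∑ c, (A' c).dim = 2 := by
  obtain ⟨r, -, hle, -, C, _, K', _, _, _, Φ', A', ι', θ', m, cls, f, hA, hs, hniso, hcls, hf, hrsum, -⟩ :=
    exists_rdim_of_isOfCMType hX h0 hcm
  have hrib := four_mul_sum_dim_le_two_pow_mtRank_hodge_one hA hs hniso hcls hX ⟨f, hf⟩
  refine ⟨C, inferInstance, K', inferInstance, inferInstance, inferInstance, Φ', A', ι', θ', m, cls, f, hA, hs, hniso,
    hcls, hf, ?_⟩
  rw [h3] at hle hrib
  rw [← hrsum] at hrib
  norm_num at hrib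
  omega

end Intrinsic

/-! ## §4 Instance-free headline (`hodgeTensorFacts_holds`) -/

section InstanceFree

/-- `dim MT(H¹(X)) ≤ 3` ⟹ all powers of the CM abelian variety `X` are divisor-generated and satisfy the Hodge
conjecture, with the tensor facts discharged. [cite: Gordon1999HodgeAVSurvey, 7.5 and 7.7] -/
theorem hodgeConjectureFor_powSucc_of_mtRank_hodge_one_le_three' {X : AbelianVariety ℂ} {n : ℕ}
    (hX : IsSmoothProjective n X.X) (h0 : 0 < X.dim) (hcm : IsOfCMType X)
    (h3 : haveI := BettiUniverse.finite hX 1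
      @HodgeStructure.mtRank _ _ _ hodgeTensorFacts_holds.{0, 0} _ _
        (BettiUniverse.hodge exists_isReal_hodgeModel_holds hX 1) ≤ 3) (N : ℕ) :
    IsDivisorGenerated (X.powSucc N) ∧ HodgeConjectureFor (X.powSucc N).dim (X.powSucc N).X := by
  haveI : HodgeTensorFacts.{0, 0} := hodgeTensorFacts_holds.{0, 0}
  exact ⟨forall_isDivisorGenerated_powSucc_of_mtRank_hodge_one_le_three hX h0 hcm h3 N,
    hodgeConjectureFor_powSucc_of_mtRank_hodge_one_le_three hX h0 hcm h3 N⟩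

end InstanceFree

/-! ## §5 Class-target display (`Ring2.ClassTargets.HCOnClass`) -/

section ClassTargets

open Summit.HodgeConjecture.HodgeConjecture.Ring2.ClassTargets (HCOnClass)

/-- **Class-target display**: the Hodge conjecture holds on the class of complex abelian varieties `B` of CM type with
`0 < dim B` and `dim MT(H¹(B)) ≤ 3` (all their powers are divisor-generated) — UNCONDITIONAL.
[cite: Gordon1999HodgeAVSurvey, 7.5 and 10.10] [cite: Deligne2000, §1] -/
theorem hcOnClass_isOfCMType_mtRank_hodge_one_le_three :
    HCOnClass fun B => IsOfCMType B ∧ 0 < B.dim ∧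
      @HodgeStructure.mtRank _ _ _ hodgeTensorFacts_holds.{0, 0}
          (BettiUniverse.finite (AbelianVariety.isSmoothProjective_holds (A := B)) 1) _
          (BettiUniverse.hodge exists_isReal_hodgeModel_holds (AbelianVariety.isSmoothProjective_holds (A := B)) 1) ≤ 3 :=
  fun _ ⟨hcm, h0, h3⟩ =>
    (hodgeConjectureFor_powSucc_of_mtRank_hodge_one_le_three' AbelianVariety.isSmoothProjective_holds h0 hcm h3 0).2

end ClassTargets

end Summit.HodgeConjecture.CorCM

end
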